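import Summits.NavierStokesRegularity.NavierStokesRegularity.Theses.TypeILiouville
import Summits.NavierStokesRegularity.NavierStokesRegularity.Theorems.TypeILiouvilleTypeIliouvilleLStubWeakAncientDriftMild
import Literature.Analysis.FluidPDE.KNSSRegularityGalileanProofs
import Literature.Analysis.FluidPDE.OseenHeatKernelBridge
import Literature.Analysis.FluidPDE.OseenMildWindowRepresentative
import Literature.Analysis.FluidPDE.KNSSOseenMildDecayTools
import Literature.Analysis.FluidPDE.TypeIAncientMild
import Literature.Analysis.FluidPDE.NSBoundedMildSmoothing
import HarnessLib

/-!
# Route TypeILiouville — `TypeIliouvilleL`, stub B: the ancient drift-mild pair in the co-moving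
# frame solves the Oseen integral equation

Support file for item stmt-NavierStokesRegularity-10661 (`TypeIliouvilleL`, the KNSS Liouville
conjecture (L)) of route `TypeILiouville` (problem `NavierStokesRegularity`); theorems only.

**Main result** (`stub_driftMild_ancient_oseen`, the Galilean step of the Oseen gauge theorem;
Koch–Nadirashvili–Seregin–Šverák 2009, §1 p. 3 and §4 (i)–(ii)). Let `(U, b)` be an *ancient*
drift-mild pair with local bounds: `U` jointly measurable and continuous on `(−∞,0) × ℝ³`, `b`
measurable, both bounded on every window `(T, 0)`, `U(t)` weakly divergence free, and
`U(t) = e^{(t−s)Δ}U(s) − ∫ₛᵗ e^{(t−σ)Δ}P∇·((U+b) ⊗ (U+b)) dσ` (`driftDuhamel`) for all `s < t < 0`.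
With the frame path `A(t) = ∫₀ᵗ 1_{(−∞,0)} b` (`driftPath` of the truncated drift; continuous,
`continuous_driftPath_indicator`) the co-moving field `V(t, y) = U(t, y + A(t))` is jointly
measurable, continuous on the slab, and solves the Oseen integral equation
`V(t) = e^{(t−s)Δ}V(s) − B¹_s(V,V)(t)` for all `s < t < 0` with the tree's kernel-realised
`oseenDuhamel`.

## Proof

Bookkeeping over the tree's Galilean covariance of the drift-mild class
(`IsKNSSDriftMild.galileanCovariance_R3`) and the heat-flow/kernel bridge
(`IsKNSSDriftMild.eq_heatExtension_sub_oseenDuhamel_three`). Fix `s < t < 0` and the window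
`(T₀, 0)`, `T₀ = s − 1`, re-clocked to `(0, −T₀)` by `τ = σ − T₀`. The pair
`U'(τ) = U(τ + T₀)`, `b'(τ) = (1_{(T₀,∞)} 1_{(−∞,0)} b)(τ + T₀)` (the drift truncated to the window,
so that it is globally bounded) is drift-mild on `(0, −T₀)` (`driftMild_window`: the drift-Duhamel
term over `(σ, τ) ⊂ (0, −T₀)` does not see the truncation, `driftDuhamel_congr_ae`, and commutes
with the time shift, `TypeIliouvilleL.WeakAncientDriftMild.driftDuhamel_comp_add_right`). By
Galilean covariance `galileanShift U' b'` is drift-mild with zero drift, hence solves the Oseen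
equation on the window; since `driftPath b' ρ = A(ρ + T₀) − A(T₀)` for `ρ ≥ 0`
(`driftPath_window`), `galileanShift U' b' ρ = V(ρ + T₀)(· − A(T₀))`, and the identity at the
window times `s − T₀ < t − T₀` is the claim after translating in space by `A(T₀)`
(`heatExtension_comp_add_right_apply`, `oseenDuhamel_comp_add_right`) and back in time
(`oseenDuhamel_congr_ae_slice`, `oseenDuhamel_translate`).

## References

* G. Koch, N. Nadirashvili, G. Seregin, V. Šverák, *Liouville theorems for the Navier–Stokes
  equations and applications*, Acta Math. 203 (2009) 83–105 = arXiv:0709.3599v1, §1 p. 3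
  (parasitic solutions, Galilean frame), §4 (i)–(ii), (4.3)–(4.4).
  [KochNadirashviliSereginSverak2009]
* A. J. Majda, A. L. Bertozzi, *Vorticity and Incompressible Flow* (CUP 2002), §1.2 (Galilean
  invariance). [MajdaBertozziCUP2002]
-/

set_option linter.dupNamespace false

noncomputable section

namespace Summit.NavierStokesRegularity.NavierStokesRegularity.Theorems

open MeasureTheory Filter Set Function Metric
open scoped Topology ENNReal
open Literature.Analysis Literature.Analysis.FluidPDE

namespace TypeIliouvilleL.DriftMildAncientOseen

/-! ### The frame path of a locally bounded ancient drift -/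

/-- A measurable drift bounded on every window `(T, 0)`, truncated to `(−∞, 0)`, is integrable on
every bounded interval (it is bounded by the window bound of `(min a c − 1, 0)` on `Ι a c`). -/
theorem intervalIntegrable_indicator {b : ℝ → EuclideanSpace ℝ (Fin 3)} (hbm : Measurable b)
    (hloc : ∀ T : ℝ, T < 0 → ∃ N : ℝ, ∀ t ∈ Ioo T 0, ‖b t‖ ≤ N) (a c : ℝ) :
    IntervalIntegrable (indicator (Iio 0) b) volume a c := by
  have hT : min (min a c) 0 - 1 < 0 := by linarith [min_le_right (min a c) 0]
  obtain ⟨N, hN⟩ := hloc _ hT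
  refine IntervalIntegrable.mono_fun' (g := fun _ => max N 0) intervalIntegrable_const
    (hbm.indicator measurableSet_Iio).aestronglyMeasurable ?_
  rw [EventuallyLE, ae_restrict_iff' measurableSet_uIoc]
  refine Eventually.of_forall fun τ hτ => ?_
  by_cases h : τ ∈ Iio (0 : ℝ)
  · rw [indicator_of_mem h]
    refine (hN τ ⟨?_, h⟩).trans (le_max_left _ _)
    have h1 : min a c < τ := hτ.1
    linarith [min_le_left (min a c) 0]
  · rw [indicator_of_notMem h, norm_zero]
    exact le_max_right _ _

/-- **The frame path `A(t) = ∫₀ᵗ 1_{(−∞,0)} b` of a measurable drift bounded on every window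
`(T, 0)` is continuous** (a primitive of a locally integrable function). -/
theorem continuous_driftPath_indicator {b : ℝ → EuclideanSpace ℝ (Fin 3)} (hbm : Measurable b)
    (hloc : ∀ T : ℝ, T < 0 → ∃ N : ℝ, ∀ t ∈ Ioo T 0, ‖b t‖ ≤ N) :
    Continuous (driftPath (indicator (Iio 0) b)) :=
  intervalIntegral.continuous_primitive (fun a c => intervalIntegrable_indicator hbm hloc a c) 0

/-- **The frame path of the window drift is the increment of `A`**: for the truncated drift
re-clocked to the window `(T₀, 0)`, `∫₀^ρ (1_{(T₀,∞)} 1_{(−∞,0)} b)(τ + T₀) dτ = A(ρ + T₀) − A(T₀)`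
for `ρ ≥ 0` (substitution `τ ↦ τ + T₀`; on `(T₀, ρ + T₀]` the outer truncation is invisible). -/
theorem driftPath_window {b : ℝ → EuclideanSpace ℝ (Fin 3)} (hbm : Measurable b)
    (hloc : ∀ T : ℝ, T < 0 → ∃ N : ℝ, ∀ t ∈ Ioo T 0, ‖b t‖ ≤ N) (T₀ : ℝ) {ρ : ℝ} (hρ : 0 ≤ ρ) :
    driftPath (fun τ => indicator (Ioi T₀) (indicator (Iio 0) b) (τ + T₀)) ρ =
      driftPath (indicator (Iio 0) b) (ρ + T₀) - driftPath (indicator (Iio 0) b) T₀ := by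
  have hi := intervalIntegrable_indicator hbm hloc
  simp only [driftPath]
  rw [intervalIntegral.integral_interval_sub_left (hi 0 (ρ + T₀)) (hi 0 T₀),
    intervalIntegral.integral_comp_add_right (indicator (Ioi T₀) (indicator (Iio 0) b)) T₀,
    zero_add]
  refine intervalIntegral.integral_congr_ae (Eventually.of_forall fun τ hτ => ?_)
  rw [uIoc_of_le (by linarith)] at hτ
  exact indicator_of_mem (show τ ∈ Ioi T₀ from hτ.1) _

/-! ### The re-clocked window pair is drift-mild -/

/-- **The ancient drift-mild pair, re-clocked to a window and with truncated drift, is drift-mild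
in the sense of KNSS.** For `T₀ < 0` and a bound `N` of `U` and `b` on `(T₀, 0)`, the pair
`U'(τ) = U(τ + T₀)`, `b'(τ) = (1_{(T₀,∞)} 1_{(−∞,0)} b)(τ + T₀)` satisfies
`IsKNSSDriftMild (−T₀) N U' b'`: the drift is measurable and globally bounded by `N`, `U'` is
jointly measurable, bounded by `N` and weakly divergence free on the window, and the drift-mild
identity on `0 < σ < τ < −T₀` is that of `(U, b)` between `σ + T₀ < τ + T₀ < 0`, because the
drift-Duhamel term over `(σ, τ)` commutes with the time shift
(`TypeIliouvilleL.WeakAncientDriftMild.driftDuhamel_comp_add_right`) and does not see the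
truncation (`driftDuhamel_congr_ae`). [cite: KochNadirashviliSereginSverak2009, §1 p. 3 and §4 (i)–(ii), (4.3)–(4.4) (arXiv:0709.3599v1 pp. 3, 8)] -/
theorem driftMild_window {U : ℝ → EuclideanSpace ℝ (Fin 3) → EuclideanSpace ℝ (Fin 3)}
    {b : ℝ → EuclideanSpace ℝ (Fin 3)} (hUm : Measurable (uncurry U)) (hbm : Measurable b)
    (hdiv : ∀ t < 0, IsWeaklyDivFree (U t))
    (hmild : ∀ s t : ℝ, s < t → t < 0 → ∀ x,
      U t x = UnboundedOperators.heatExtension (U s) (t - s) x - driftDuhamel U b s t x)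
    {T₀ N : ℝ} (hT₀ : T₀ < 0) (hNU : ∀ t ∈ Ioo T₀ 0, ∀ x, ‖U t x‖ ≤ N)
    (hNb : ∀ t ∈ Ioo T₀ 0, ‖b t‖ ≤ N) :
    IsKNSSDriftMild (-T₀) N (fun τ z => U (τ + T₀) z)
      (fun τ => indicator (Ioi T₀) (indicator (Iio 0) b) (τ + T₀)) := by
  have hN0 : 0 ≤ N := (norm_nonneg _).trans (hNU (T₀ / 2) ⟨by linarith, by linarith⟩ 0)
  refine
    { measurable_drift := ((hbm.indicator measurableSet_Iio).indicator measurableSet_Ioi).comp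
        (measurable_id.add_const T₀)
      norm_drift_le := fun τ => ?_
      measurable := hUm.comp ((measurable_fst.add_const T₀).prodMk measurable_snd)
      norm_le := fun τ hτ x => hNU (τ + T₀) ⟨by linarith [hτ.1], by linarith [hτ.2]⟩ x
      ae_isWeaklyDivFree := (ae_restrict_mem measurableSet_Ioo).mono fun τ hτ =>
        hdiv (τ + T₀) (by linarith [hτ.2])
      mild := fun σ τ hσ hστ hτT x => ?_ }
  · -- the global drift bound
    show ‖indicator (Ioi T₀) (indicator (Iio 0) b) (τ + T₀)‖ ≤ N
    by_cases h1 : τ + T₀ ∈ Ioi T₀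
    · rw [indicator_of_mem h1]
      by_cases h2 : τ + T₀ ∈ Iio (0 : ℝ)
      · rw [indicator_of_mem h2]
        exact hNb _ ⟨h1, h2⟩
      · rw [indicator_of_notMem h2, norm_zero]
        exact hN0
    · rw [indicator_of_notMem h1, norm_zero]
      exact hN0
  · -- the drift-mild identity on the window = that of `(U, b)`, re-clocked
    have hm := hmild (σ + T₀) (τ + T₀) (by linarith) (by linarith) x
    rw [add_sub_add_right_eq_sub] at hm
    have hd := TypeIliouvilleL.WeakAncientDriftMild.driftDuhamel_comp_add_right U
      (indicator (Ioi T₀) (indicator (Iio 0) b)) T₀ σ τ x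
    have hc : driftDuhamel U (indicator (Ioi T₀) (indicator (Iio 0) b)) (σ + T₀) (τ + T₀) x =
        driftDuhamel U b (σ + T₀) (τ + T₀) x := by
      refine driftDuhamel_congr_ae (by linarith) ((ae_restrict_mem measurableSet_Ioo).mono
        fun σ' hσ' => Eventually.of_forall fun y => ?_) x
      have h1 : σ' ∈ Ioi T₀ := show T₀ < σ' by linarith [hσ'.1]
      have h2 : σ' ∈ Iio (0 : ℝ) := show σ' < 0 by linarith [hσ'.2]
      show U σ' y + indicator (Ioi T₀) (indicator (Iio 0) b) σ' = U σ' y + b σ'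
      rw [indicator_of_mem h1, indicator_of_mem h2]
    show U (τ + T₀) x = UnboundedOperators.heatExtension (fun z => U (σ + T₀) z) (τ - σ) x -
      driftDuhamel (fun τ z => U (τ + T₀) z)
        (fun τ => indicator (Ioi T₀) (indicator (Iio 0) b) (τ + T₀)) σ τ x
    rw [hd, hc]
    exact hm

end TypeIliouvilleL.DriftMildAncientOseen

open TypeIliouvilleL.DriftMildAncientOseen in
/-- **Stub B (`stub_driftMild_ancient_oseen`) of the line `registered` (crux `TypeIliouvilleL`):
an ancient drift-mild pair, seen from the frame co-moving with its drift, solves the Oseen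
integral equation.** If `U : ℝ → ℝ³ → ℝ³` is jointly measurable and continuous on the open
backward slab, `b` is measurable, `U` and `b` are bounded on every window `(T, 0)`, every slice
`U(t)`, `t < 0`, is weakly divergence free and
`U(t) = e^{(t−s)Δ}U(s) − ∫ₛᵗ e^{(t−σ)Δ}P∇·((U+b) ⊗ (U+b)) dσ` for all `s < t < 0`, then there is a
continuous frame path `A` (namely `A(t) = ∫₀ᵗ 1_{(−∞,0)} b`) such that `V(t, y) = U(t, y + A(t))` is
jointly measurable, continuous on the slab, and `V(t) = e^{(t−s)Δ}V(s) − B¹_s(V,V)(t)` pointwise for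
all `s < t < 0` (Galilean invariance of Navier–Stokes with the time-dependent frame velocity
`b(t)`: the tree's `IsKNSSDriftMild.galileanCovariance_R3` on the windows `(s − 1, 0)`, read
through `IsKNSSDriftMild.eq_heatExtension_sub_oseenDuhamel_three`; module docstring). [cite: KochNadirashviliSereginSverak2009, §1 p. 3 and §4 (i)–(ii), (4.3)–(4.4) (arXiv:0709.3599v1 pp. 3, 8)] -/
theorem stub_driftMild_ancient_oseen :
    ∀ (U : ℝ → EuclideanSpace ℝ (Fin 3) → EuclideanSpace ℝ (Fin 3))
      (b : ℝ → EuclideanSpace ℝ (Fin 3)),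
      Measurable (uncurry U) → Measurable b →
      ContinuousOn (uncurry U) (Iio 0 ×ˢ univ) →
      (∀ T : ℝ, T < 0 → ∃ N : ℝ,
        (∀ t ∈ Ioo T 0, ∀ x, ‖U t x‖ ≤ N) ∧ ∀ t ∈ Ioo T 0, ‖b t‖ ≤ N) →
      (∀ t < 0, Literature.Analysis.FluidPDE.IsWeaklyDivFree (U t)) →
      (∀ s t : ℝ, s < t → t < 0 → ∀ x,
        U t x = Literature.Analysis.UnboundedOperators.heatExtension (U s) (t - s) x -
          Literature.Analysis.FluidPDE.driftDuhamel U b s t x) →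
      ∃ A : ℝ → EuclideanSpace ℝ (Fin 3), Continuous A ∧
        Measurable (uncurry fun t y => U t (y + A t)) ∧
        ContinuousOn (uncurry fun t y => U t (y + A t)) (Iio 0 ×ˢ univ) ∧
        ∀ s t : ℝ, s < t → t < 0 → ∀ y,
          U t (y + A t) =
            Literature.Analysis.UnboundedOperators.heatExtension (fun z => U s (z + A s)) (t - s) y -
              Literature.Analysis.FluidPDE.oseenDuhamel 1 s
                (fun τ z => U τ (z + A τ)) (fun τ z => U τ (z + A τ)) t y := by
  intro U b hUm hbm hcont hloc hdiv hmild
  have hlocb : ∀ T : ℝ, T < 0 → ∃ N : ℝ, ∀ t ∈ Ioo T 0, ‖b t‖ ≤ N := fun T hT => by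
    obtain ⟨N, -, hN⟩ := hloc T hT
    exact ⟨N, hN⟩
  -- ## the frame path `A = ∫₀ 1_{(−∞,0)} b`
  obtain ⟨A, hA⟩ : ∃ A : ℝ → EuclideanSpace ℝ (Fin 3), driftPath (indicator (Iio 0) b) = A :=
    ⟨_, rfl⟩
  have hAc : Continuous A := by
    rw [← hA]
    exact continuous_driftPath_indicator hbm hlocb
  refine ⟨A, hAc, hUm.comp (measurable_fst.prodMk (measurable_snd.add
    (hAc.measurable.comp measurable_fst))), ?_, fun s t hst ht0 y => ?_⟩
  · -- joint continuity on the slab (composition with the shear `(t, y) ↦ (t, y + A t)`)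
    have h : ContinuousOn (fun q : ℝ × EuclideanSpace ℝ (Fin 3) =>
        uncurry U (q.1, q.2 + A q.1)) (Iio 0 ×ˢ univ) := by
      refine hcont.comp (continuous_fst.prodMk
        (continuous_snd.add (hAc.comp continuous_fst))).continuousOn ?_
      intro q hq
      exact mk_mem_prod hq.1 (mem_univ _)
    exact h
  · -- ## the Oseen identity in the co-moving frame
    set V : ℝ → EuclideanSpace ℝ (Fin 3) → EuclideanSpace ℝ (Fin 3) :=
      fun t y => U t (y + A t) with hV
    -- the window `(T₀, 0)`, `T₀ = s − 1`, re-clocked to `(0, −T₀)`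
    obtain ⟨T₀, hT₀⟩ : ∃ T₀ : ℝ, T₀ = s - 1 := ⟨_, rfl⟩
    have hT₀0 : T₀ < 0 := by linarith
    obtain ⟨N, hNU, hNb⟩ := hloc T₀ hT₀0
    have hwin := driftMild_window hUm hbm hdiv hmild hT₀0 hNU hNb
    have hGal := IsKNSSDriftMild.galileanCovariance_R3 hwin
    have hs1 : 0 < s - T₀ := by linarith
    have hst' : s - T₀ < t - T₀ := by linarith
    have htT : t - T₀ < -T₀ := by linarith
    have key := (hGal.eq_heatExtension_sub_oseenDuhamel_three hs1 hst' htT).1 (y + A T₀)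
    -- the Galilean transform of the window pair is `V`, re-clocked and translated by `−A T₀`
    have hG : ∀ ρ : ℝ, 0 ≤ ρ →
        galileanShift (fun τ z => U (τ + T₀) z)
          (fun τ => indicator (Ioi T₀) (indicator (Iio 0) b) (τ + T₀)) ρ =
          fun z => V (ρ + T₀) (z + -A T₀) := by
      intro ρ hρ
      funext z
      simp only [galileanShift_apply, hV]
      rw [driftPath_window hbm hlocb T₀ hρ, hA]
      congr 1
      abel
    have hVt : galileanShift (fun τ z => U (τ + T₀) z)
        (fun τ => indicator (Ioi T₀) (indicator (Iio 0) b) (τ + T₀)) (t - T₀) =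
        fun z => V t (z + -A T₀) := by
      rw [hG (t - T₀) (by linarith), sub_add_cancel]
    have hVs : galileanShift (fun τ z => U (τ + T₀) z)
        (fun τ => indicator (Ioi T₀) (indicator (Iio 0) b) (τ + T₀)) (s - T₀) =
        fun z => V s (z + -A T₀) := by
      rw [hG (s - T₀) hs1.le, sub_add_cancel]
    have hVτ : ∀ ρ ∈ Ioo (s - T₀) (t - T₀),
        galileanShift (fun τ z => U (τ + T₀) z)
          (fun τ => indicator (Ioi T₀) (indicator (Iio 0) b) (τ + T₀)) ρ =ᵐ[volume]
          (fun ρ z => V (ρ + T₀) (z + -A T₀)) ρ :=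
      fun ρ hρ => Filter.EventuallyEq.of_eq (hG ρ (hs1.le.trans hρ.1.le))
    have hD : oseenDuhamel 1 (s - T₀)
        (galileanShift (fun τ z => U (τ + T₀) z)
          (fun τ => indicator (Ioi T₀) (indicator (Iio 0) b) (τ + T₀)))
        (galileanShift (fun τ z => U (τ + T₀) z)
          (fun τ => indicator (Ioi T₀) (indicator (Iio 0) b) (τ + T₀))) (t - T₀) (y + A T₀) =
        oseenDuhamel 1 s V V t y := by
      have e1 : oseenDuhamel 1 (s - T₀) (fun ρ z => V (ρ + T₀) (z + -A T₀))
          (fun ρ z => V (ρ + T₀) (z + -A T₀)) (t - T₀) (y + A T₀) =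
          oseenDuhamel 1 (s - T₀) (fun ρ => V (ρ + T₀)) (fun ρ => V (ρ + T₀)) (t - T₀)
            (y + A T₀ + -A T₀) :=
        oseenDuhamel_comp_add_right 1 (s - T₀) (fun ρ => V (ρ + T₀)) (fun ρ => V (ρ + T₀))
          (-A T₀) (t - T₀) (y + A T₀)
      rw [oseenDuhamel_congr_ae_slice hVτ hVτ (y + A T₀), e1, oseenDuhamel_translate,
        sub_add_cancel, sub_add_cancel, add_neg_cancel_right]
    have hH : UnboundedOperators.heatExtension (fun z => V s (z + -A T₀)) (t - T₀ - (s - T₀))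
        (y + A T₀) = UnboundedOperators.heatExtension (V s) (t - s) y := by
      rw [heatExtension_comp_add_right_apply (V s) (-A T₀), add_neg_cancel_right,
        show t - T₀ - (s - T₀) = t - s by ring]
    rw [hVt, hVs, hD, hH] at key
    simp only [add_neg_cancel_right] at key
    simpa only [hV] using key

end Summit.NavierStokesRegularity.NavierStokesRegularity.Theorems

end
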